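import Mathlib
import HarnessLib
import HarnessLib.Audit
import Summits.AtomisticToContinuum.Statement

/-!
Route: RiemannSelfSimilar

CLOSED (retired) 2026-08-15T13:45:56Z by operator:999:1257524 — reason: not-a-thesis: assembly does not conclude the sub-problem Statement — note: D-0027 §2.1 audit (human 2026-08-15: routes that do not decide the summit are removed): the assembly concludes `WallFanLimit`, not the sub-problem statement; a NEW conforming route may be opened from the same idea (generated `closes : … → _root_.HydrodynamicLimit`).. The file is kept as the record of this route; refuted decls are indexed as negative knowledge (`ledger negatives`).

# Route RiemannSelfSimilar — Trade N for t — the domain-wall (Riemann) fan of the hard-sphere gas,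
closed on the PDE side by rarefaction-only relative-energy uniqueness

COMPANION-TARGET ROUTE (realises card trade-n-for-t-riemann-self-similar). Target X =
`WallFanLimit`: release the hard-sphere gas of the
conjunct (N+1 spheres of diameter σ(N+1)^(-1/3) on 𝕋³, local Gibbs law) from the two-half-space
DOMAIN-WALL datum — density 1, temperature θ̄,
velocity a·sgn(x₁)·e₁ (pull-apart at x₁ = 0; 0 < a < a₀(θ̄), σ < σ₀) — and show that inside the
causal slab |x₁| < 1/8, for macroscopic times
t ∈ (0, t₁), the empirical density / momentum / energy fields converge in probability to those of
the self-similar two-rarefaction FAN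
W(x₁/t) = (R, U e₁, Θ) of the hard-sphere Euler system (a continuous self-similar weak solution of
the 1-D system, ∃-quantified). It suffices
to show FanLocalEquilibrium (one-particle local equilibrium onto the fan, crux 2); the PDE
identification behind it is
LocalRarefactionUniquenessHs (crux 3, FKV relative energy for the hs equation of state,
cone-localised) and its kinetic half is
KineticFluxClosure (crux 4). HONEST PLACEMENT: X ↛ HydrodynamicLimit (one discontinuous datum,
non-classical solution) and
HydrodynamicLimit ↛ X (the conjunct quantifies classical solutions only); an item `X →
HydrodynamicLimit` would be the conjunct in disguise
and is NOT filed. X is the conjunct's statement evaluated at the first datum BEYOND its solution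
class at which the PDE side is still uniquely
determined for bounded admissible weak solutions (rarefaction-only pattern:
FeireislKremlVasseur2015; WildSolutionsBarrier evasion (ii)), i.e. the
cheapest arena in which the universal closure crux of the sub-problem (FluxClosure,
stmt-AtomisticToContinuum-0823 of route
DissipativeWeakStrong; RelEntropyVanishing of the entropy routes) can be proved or refuted for
deterministic hard spheres, and the typed
torus shadow of the card's N-FREE statement RSS (one infinite gas, s → ∞ in the frame x/s; filed
informal with its definition requests):
by hyperbolic covariance the hydrodynamic limit for scale-free data IS the long-time self-similar
relaxation of one system (Rost1981 for
TASEP; here for Newtonian hard spheres).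
Lean: `∀ x1 : Literature.MathematicalPhysics.KineticTheory.T3 → ℝ, (∀ x, x1 x = ((AddCircle.equivIco
(1:ℝ) (-(1/2:ℝ))) (x 0) : ℝ)) → ∀ e : Literature.MathematicalPhysics.KineticTheory.V3, e =
EuclideanSpace.single 0 1 → ∀ θb : ℝ, 0 < θb → ∃ a₀ : ℝ, 0 < a₀ ∧ ∀ a : ℝ, 0 < a → a < a₀ → ∃ σ₀ :
ℝ, 0 < σ₀ ∧ ∀ σ : ℝ, 0 < σ → σ < σ₀ → ∃ R U Θ : ℝ → ℝ, (Continuous R ∧ Continuous U ∧ Continuous Θ ∧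
(∃ m M : ℝ, 0 < m ∧ ∀ ζ, m ≤ R ζ ∧ R ζ ≤ M ∧ m ≤ Θ ζ ∧ Θ ζ ≤ M ∧ |U ζ| ≤ M) ∧ (∃ L : ℝ, ∀ ζ, L ≤ |ζ|
→ R ζ = 1 ∧ Θ ζ = θb ∧ U ζ = a * Real.sign ζ) ∧ ∀ φ : ℝ → ℝ, ContDiff ℝ (⊤ : ℕ∞) φ →
HasCompactSupport φ → (∫ ζ, (R ζ * U ζ - ζ * R ζ) * deriv φ ζ = ∫ ζ, R ζ * φ ζ) ∧ (∫ ζ, (R ζ * U ζ ^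
2 + Literature.MathematicalPhysics.KineticTheory.hsPressure σ (R ζ) (Θ ζ) - ζ * (R ζ * U ζ)) * deriv
φ ζ = ∫ ζ, R ζ * U ζ * φ ζ) ∧ (∫ ζ,
((Literature.MathematicalPhysics.KineticTheory.totalEnergyDensity (R ζ) (U ζ • e) (Θ ζ) +
Literature.MathematicalPhysics.KineticTheory.hsPressure σ (R ζ) (Θ ζ)) * U ζ - ζ *
Literature.MathematicalPhysics.KineticTheory.totalEnergyDensity (R ζ) (U ζ • e) (Θ ζ)) * deriv φ ζ =
∫ ζ, Literature.MathematicalPhysics.KineticTheory.totalEnergyDensity (R ζ) (U ζ • e) (Θ ζ) * φ ζ)) ∧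
∃ t₁ : ℝ, 0 < t₁ ∧ ∀ Φ : ((N : ℕ) → Literature.Analysis.FluidPDE.HardSphereFlow
(Literature.Analysis.FluidPDE.Torus.geometry (Fin 3))
(Literature.MathematicalPhysics.KineticTheory.hsDiameter σ N) (N + 1)),
Literature.MathematicalPhysics.KineticTheory.TendstoHydroFieldsAt (fun N =>
Literature.MathematicalPhysics.KineticTheory.localGibbsLaw σ (fun _ => 1) (fun x => (a * Real.sign
(x1 x)) • e) (fun _ => θb) N (Φ N)) Φ (fun _ _ => (1:ℝ)) (fun _ x => (a * Real.sign (x1 x)) • e)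
(fun _ _ => θb) 0 → ∀ t ∈ Set.Ioo 0 t₁, ∀ χ : Literature.MathematicalPhysics.KineticTheory.T3 → ℝ,
Continuous χ → (∀ x, 1/8 ≤ |x1 x| → χ x = 0) → ∀ δ : ℝ, 0 < δ → Filter.Tendsto (fun N =>
Literature.MathematicalPhysics.KineticTheory.localGibbsLaw σ (fun _ => 1) (fun x => (a * Real.sign
(x1 x)) • e) (fun _ => θb) N (Φ N) {z | δ <
|Literature.MathematicalPhysics.KineticTheory.empiricalDensityField ((Φ N).flow t z) χ - ∫ x, χ x *
R (x1 x / t)|}) Filter.atTop (nhds 0) ∧ Filter.Tendsto (fun N =>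
Literature.MathematicalPhysics.KineticTheory.localGibbsLaw σ (fun _ => 1) (fun x => (a * Real.sign
(x1 x)) • e) (fun _ => θb) N (Φ N) {z | δ <
‖Literature.MathematicalPhysics.KineticTheory.empiricalMomentumField ((Φ N).flow t z) χ - ∫ x, (χ x
* (R (x1 x / t) * U (x1 x / t))) • e‖}) Filter.atTop (nhds 0) ∧ Filter.Tendsto (fun N =>
Literature.MathematicalPhysics.KineticTheory.localGibbsLaw σ (fun _ => 1) (fun x => (a * Real.sign
(x1 x)) • e) (fun _ => θb) N (Φ N) {z | δ <
|Literature.MathematicalPhysics.KineticTheory.empiricalEnergyField ((Φ N).flow t z) χ - ∫ x, χ x *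
Literature.MathematicalPhysics.KineticTheory.totalEnergyDensity (R (x1 x / t)) (U (x1 x / t) • e) (Θ
(x1 x / t))|}) Filter.atTop (nhds 0)`

## Assembly
FanLocalEquilibrium → WallFanLimit is bookkeeping plus one real-analysis fact: take g = χ(x),
χ(x)v_i, χ(x)|v|²/2 (all continuous with
|g| ≤ C(1+|v|²) and vanishing for |x₁| ≥ 1/8), and evaluate the Maxwellian moments ∫ M_{ρ,u,θ}(v)(1,
v, |v|²/2) dv = (ρ, ρu, ρ(|u|²/2 + 3θ/2))
(Gaussian integrals in ℝ³; Mathlib). The conclusion is the route's own target `WallFanLimit`, NOT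
the conjunct: this is a companion route (see
§ Thesis, HONEST PLACEMENT); its summit-side use is (a) the cheapest typed instance of the closure
crux shared in substance with FluxClosure
(stmt-0823) / RelEntropyVanishing, (b) a discriminating MD/theorem test of chaotic vs integrable
closure (DoyonSpohn2017), (c) the seed of the
N-free statement RSS once the infinite-volume definitions land.

Rationale: WHY THIS LINE. Mechanism (card, points 1–3): for Riemann data the local Gibbs law is scale-free, so
"N → ∞ at fixed t" and "s → ∞ for one infinite gas"
coincide (trade N for t; Rost1981 is the stochastic prototype, ChenFrid2000 the PDE template:
uniqueness + scaling invariance ⇒ asymptotic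
stability of Riemann solutions); in log-time the Euler fan is a fixed point and closure is needed
only along one relaxing orbit. The datum is
CHOSEN so that the PDE side closes without smoothness, smallness or BV: symmetric pull-apart data
give two rarefactions and no shock, and
rarefaction-only Riemann solutions of the full multi-d Euler system are unique among bounded
admissible weak solutions
(FeireislKremlVasseur2015 Thm 2.1, read pp. 1–6: ideal gas, ℝ×𝕋¹, relative energy with ballistic
free energy; FeireislKreml2015 isentropic;
FeireislNeves2025 vanishing-dissipation version) — imported area: relative-energy stability theory
of hyperbolic conservation laws
(Dafermos2005 Ch. 5, FeireislNovotny2012). What is new relative to the seven open routes: all of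
them attack smooth profiles on [0,T) with a
generic closure statement; this line isolates ONE datum where (a) the far field is exact
equilibrium, (b) the flow only expands (density and
temperature two-sidedly bounded by the data), (c) the target is Lipschitz for t > 0 and isentropic,
(d) uniqueness holds in the largest class a
particle limit can land in, and (e) the integrable twin is solved exactly and is NOT Euler (hard
rods from a domain wall relax to the GHD
profile, DoyonSpohn2017) — so an MD experiment or a theorem here discriminates chaotic from
integrable closure at the level of a
self-similar profile. Physical analogy used with an explicit dictionary (card): partitioning
protocol ↦ Riemann datum, ray x/t ↦
self-similar variable, GHD profile ↦ Euler fan, Kn → 0 ↦ s → ∞.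

RANKED CRUXES. #0 WallFanLimit (target) — X as in § Thesis: for every θ̄ > 0 there is a₀ > 0, for
every 0 < a < a₀ there is σ₀ > 0, for every 0 < σ < σ₀ there are a continuous self-similar
pull-apart fan (R, U, Θ) of the hard-sphere Euler system with reduced diameter σ (bounded, ρ, θ ≥ m
> 0, far field (1, ±a, θ̄), the three self-similar balance laws in D′(ℝ)) and t₁ > 0 such that for
every family of hard-sphere flows, if the local Gibbs laws of the domain-wall datum (activity 1,
velocity a·sgn(x₁)e₁, temperature θ̄) satisfy the LLN at t = 0, then for every t ∈ (0, t₁) and every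
continuous χ vanishing on {|x₁| ≥ 1/8} the empirical density, momentum and energy fields at time t
converge in probability to ∫χ R(x₁/t), ∫χ R U(x₁/t) e₁, ∫χ E_W(x₁/t) (x₁ = the coordinate in [−1/2,
1/2); e₁ and x₁ are bound by defining hypotheses at the head of the term). (why it might fail: False
if the domain-wall gas relaxes onto a non-Euler self-similar profile (1-D hard rods do exactly that:
DoyonSpohn2017) or keeps an anisotropic-pressure plateau inside the fan; vacuity risk if the t = 0
LLN hypothesis fails (support WallDataLLN).) [Spohn1991, OllaVaradhanYau1993,
FeireislKremlVasseur2015 = arXiv:1412.1903 = doi:10.1137/140999827, Rost1981 =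
doi:10.1007/bf00536194, DoyonSpohn2017 = doi:10.1088/1742-5468/aa7abf, ChakrabortiEtAl2021 =
doi:10.1103/physrevlett.126.244503]
#2 FanLocalEquilibrium (crux) — (card R1, the closure crux in its strong one-particle form) same
quantifier prefix as the target; conclusion: for t ∈ (0, t₁) and every continuous g(x, v) with |g| ≤
C(1 + |v|²) vanishing for |x₁| ≥ 1/8, ∫ g d(empirical measure at time t) → ∫∫ g(x, v) R(x₁/t)
M_{U(x₁/t)e₁, Θ(x₁/t)}(v) dv dx in probability — the one-particle law inside the causal slab is the
local Maxwellian of the fan, with energy moments (uniform integrability of |v|² is part of the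
claim). Natural proof currency (card point 2): Cesàro averages in log-time τ = log s of the
self-similarly rescaled state, for which limit points are automatically self-similar; identification
by LocalRarefactionUniquenessHs. [deps: LocalRarefactionUniquenessHs, KineticFluxClosure]
[difficulty: open-problem] (why it might fail: Closure for deterministic hard spheres is open even
here: expansion along e₁ cools v₁ first; if collisions in the fan (rate ∝ σ²N^(1/3) per unit time)
leave an O(1) velocity anisotropy, or fast particles from the colliding wall pollute the slab, the
one-particle law is not the fan's Maxwellian.) [Spohn1991, OllaVaradhanYau1993, Rost1981 =
doi:10.1007/bf00536194, DoyonSpohn2017 = doi:10.1088/1742-5468/aa7abf,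
BoldrighiniDobrushinSukhov1983]
#3 LocalRarefactionUniquenessHs (crux) — (card R3a; PDE) FKV for the hard-sphere equation of state,
localised to a domain of dependence: ∃ η₀ > 0 such that for every σ > 0, θ̄ > 0, a > 0 and every
continuous self-similar pull-apart fan (R, U, Θ) with packing Rσ³ < η₀ there is a signal speed c > 0
such that for every t₁ > 0, every bounded admissible weak solution (ρ, u, θ) of the hs-Euler system
in the cone {0 < t < t₁, |x₁| < 1/4 − ct} over the wall datum — measurable, m ≤ ρ, θ ≤ M, |u| ≤ M,
packing < η₀, weak mass/momentum/energy identities and the entropy inequalities ∂ₜ(ρb(s)) +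
div(ρb(s)u) ≥ 0 for all b ∈ C¹ with b′ ≥ 0 (s = 3/2 log θ − log ρ − f_ex(ρσ³)), all against smooth
test functions supported inside the cone — coincides a.e. in the cone with (R, U e₁, Θ)(x₁/t).
FeireislKremlVasseur2015 Thm 2.1 is the ideal-gas, ℝ×𝕋¹, global version. (In the Lean term the
abbreviations x1 = coordinate in [−1/2,1/2), e = e₁, En = totalEnergyDensity, Dt/Dx = torus
time/partial derivatives, pr = hsPressure σ, s = hs specific entropy, C = smooth test functions
supported inside the cone are bound by defining hypotheses at the head, to stay under the gate's
4000-character cap; vector test functions enter componentwise.) [deps: PullApartFanExists]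
[difficulty: L] (why it might fail: FKV §4 uses ideal-gas identities (Θ = R^(1/c_v)e^(S/c_v),
|∂Θ/∂U|² = Θ/(c_v(c_v+1))) to sign the singular cross terms; for p = ρθZ(ρσ³) they must be redone,
and the cone-localised relative energy with a comparator singular at t = 0 (boundary flux sign) is
not in print.) [FeireislKremlVasseur2015 = arXiv:1412.1903 = doi:10.1137/140999827,
FeireislKreml2015 = doi:10.1142/s0219891615500149, FeireislNeves2025 =
doi:10.1016/j.jfa.2025.110840, ChenFrid2000 = doi:10.1090/s0002-9947-00-02660-x, Dafermos2005,
FeireislNovotny2012, MenikoffPlohr1989 = doi:10.1103/RevModPhys.61.75]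
#4 KineticFluxClosure (crux) — (kinetic half of flux closure; the collisional half — contact
correlations giving ρθ(Z − 1) — stays inside crux 2's layer-2 split) same prefix as the target;
conclusion: for t ∈ (0, t₁), continuous χ vanishing for |x₁| ≥ 1/8 and j, k ∈ Fin 3, the empirical
kinetic stress ∫ χ(x) v_j v_k d(emp. measure at t) → ∫ χ (R U² e₁⊗e₁ + RΘ𝟙)_{jk}(x₁/t) dx and the
empirical kinetic energy flux ∫ χ(x) v_j |v|²/2 → ∫ χ (E_W + RΘ) U (e₁)_j (x₁/t) dx in probability
(Maxwellian second and third moments of the fan). [deps: FanLocalEquilibrium] [difficulty: XL] (why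
it might fail: Third velocity moments need uniform integrability of |v|³ at time t, which no
conservation law supplies (OVY exclude |p|²/2 for this reason: HighMomentumCutoffBarrier); a
vanishing fraction of fast particles made by collision cascades in the fan could carry O(1) energy
flux.) [Spohn1991, OllaVaradhanYau1993, EyinkLebowitzSpohn1991]
#9 PullApartFanExists (support) — (classical Riemann problem for the hs gas) for every θ̄ > 0 there
is a₀ > 0 (below the vacuum threshold) such that for 0 < a < a₀ there is σ₀ > 0 with: for every 0 ≤
σ < σ₀ a continuous self-similar pull-apart fan (R, U, Θ) exists (two centred rarefaction waves and
a constant middle state on one isentrope; σ = 0 is the explicit γ = 5/3 ideal-gas fan, small σ > 0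
needs Z smooth near 0, cf. HsEosLowDensity stmt-AtomisticToContinuum-0768). [difficulty: M]
[MenikoffPlohr1989 = doi:10.1103/RevModPhys.61.75, Dafermos2005, ChenFrid2000 =
doi:10.1090/s0002-9947-00-02660-x]
#9 PullApartFanUnique (support) — uniqueness of the continuous self-similar pull-apart fan among
continuous self-similar weak solutions with the same far field (structure of continuous self-similar
solutions of strictly hyperbolic genuinely nonlinear systems: constant states and centred
rarefactions); pins the ∃-quantified fan of the target. [difficulty: M] [Dafermos2005, ChenFrid2000
= doi:10.1090/s0002-9947-00-02660-x, MenikoffPlohr1989 = doi:10.1103/RevModPhys.61.75]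
#9 WallDataLLN (support) — non-vacuity of the target's hypothesis: for θ̄ > 0, a > 0 and σ small,
the local Gibbs laws of the domain-wall datum are probability measures for every N and every flow
family and satisfy the LLN at t = 0 towards (1, a·sgn(x₁)e₁, 1·(a²/2 + 3θ̄/2)) (positions are the
EQUILIBRIUM hard-sphere canonical measure at packing σ³; velocities independent local Maxwellians;
low-density decay of correlations, cf. localGibbs_lln / LocalGibbsConcentration
stmt-AtomisticToContinuum-0767). [difficulty: M] [Spohn1991, Ruelle1969, LebowitzPenrose1964]

TWO-LAYER PLAN. Foreseen glued split of the rank-2 node once crux 3 closes (k = 3, depth 1):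
FanLocalEquilibrium ⇐ CesaroSelfSimilarClosure (log-time
Cesàro flux closure with admissibility for the domain-wall gas: limit points of the self-similarly
rescaled (fields, kinetic + collisional
fluxes) are bounded admissible weak solutions in the cone — the card's R1 in its native currency) →
SlabLightCone (finite propagation in
probability at the Euler scale: the state in {1/8 ≤ |x₁| ≤ 3/8} stays o(1)-close to the far-field
equilibria for t < t₁; card R2, consumes
relay-race-light-cone) → LocalRarefactionUniquenessHs → FanLocalEquilibrium (compactness by the
packing bound, identification, uniqueness,
Cesàro-to-plain upgrade by uniqueness of the limit). KineticFluxClosure ⇐ FanLocalEquilibrium →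
CubicMomentTightness → KineticFluxClosure.
LocalRarefactionUniquenessHs ⇐ HsRelativeEnergyInequality (cone version, hs ballistic free energy;
needs HsEntropyConvex stmt-0817) →
FanCrossTermSign (FKV §4 for p = ρθZ) → LocalRarefactionUniquenessHs. Nothing of this is filed now.

KILL CRITERIA. A theorem or a certified MD computation exhibiting, for the domain-wall datum at some
small σ, convergence of the slab fields to a
self-similar profile OTHER than the hs-Euler fan (e.g. a persistent longitudinal/transverse
temperature split inside the rarefactions, the
hard-rod-like scenario of DoyonSpohn2017) refutes WallFanLimit and FanLocalEquilibrium at once —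
close `refuted:WallFanLimit`, and the
witness is first-rate negative knowledge for every closure route (it would strongly suggest
¬FluxClosure 0823). ¬KineticFluxClosure with
FanLocalEquilibrium intact ⇒ pivot: restate the target with energy tested only against bounded
velocity cut-offs. ¬LocalRarefactionUniquenessHs
(a second bounded admissible solution of the pull-apart problem for the hs EOS) ⇒ pivot to the σ → 0
iterated-limit target (ideal-gas fan,
FKV verbatim) and hand the witness to WildSolutionsBarrier as a new kernel. FluxClosure (0823) or
RelEntropyVanishing proved for general
data would moot cruxes 2 and 4 in substance (not formally: discontinuous datum).

NOT DECOMPOSED YET. The N-free statement RSS itself and the equivalence lemma "RSS ⇔ infinite-volume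
hyperbolic-scaling limit for scale-free data" (card R4)
— filed INFORMAL right after open together with two definition requests (infinite-volume hard-sphere
flow à la Alexander; infinite-volume
Riemann local Gibbs law), because no infinite-particle object exists in the tree (the same
definitions are wanted by GibbsErgodicity
stmt-0779); the light cone, the Cesàro log-time closure, cubic-moment tightness, the hs
relative-energy inequality (layer-2 children above);
the shock-containing Riemann data (Sod tube, colliding streams), for which self-similarity in Cesàro
log-time is the proposed selection
principle (card R3b) — a separate route if this one moves; the a → 0 linear corner (step-datum form
of Spohn's correlation conjecture),
owned by the linear-floor cards; explicit values of a₀ (vacuum threshold 3c(θ̄) for γ = 5/3 at σ =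
0), c and t₁ (kept existential).

CHEAPEST FALSIFIER. (i) Event-driven MD of the pull-apart protocol (slab geometry, N ≈ 10⁵–10⁶,
packing σ³ ∈ {0.05, 0.2}, a = 0.5√θ̄): do the t-rescaled
density/velocity/temperature profiles at 50, 100, 200 mean free times collapse onto the hs-Euler
two-rarefaction fan, and is the kinetic
temperature ISOTROPIC inside the fans (KineticFluxClosure with j = k vs j ≠ k)? Non-collapse or a
non-shrinking anisotropy plateau kills the
line (kit job not run in plancard mode — first task for a refuter with compute). (ii) Paper check of
crux 3: redo FKV §4.1–4.2 with
p = ρθZ(η), e = 3θ/2: does the cross term still close with (ηZ)′ > 0 alone? If it needs more (e.g.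
convexity of Z), the crux acquires an
explicit low-packing hypothesis — cheap, decisive for rank 3. (iii) Lookup: is a cone-localised FKV
already in print (Feireisl–Kreml–Vasseur
follow-ups, FeireislNeves2025, Kang–Vasseur–Wang a-contraction for planar rarefactions)? If yes,
crux 3 drops to support.

NUMBERS. Ideal monatomic limit σ → 0: γ = 5/3, c_v = 3/2, sound speed c = √(5θ̄/3); pull-apart data
avoid vacuum iff 2a < 2·2c/(γ−1) = 6c, i.e.
a < 3c(θ̄) (a₀ at σ = 0); fan edges travel at ±(a + c) so the causal slab |x₁| < 1/8 is free of the
colliding wall's influence for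
t < (1/8)/(a + c_max) (t₁ scale); collisions per particle per unit macroscopic time ≍ σ²(N+1)^(1/3)
→ ∞ (dynamical Knudsen number
≍ 1/(σ² t (N+1)^(1/3))). FKV class constants: 0 < ρ ≤ ρ̄, 0 < θ ≤ θ̄, |s| < s̄, |u| < ū
(FeireislKremlVasseur2015 (2.1)). Items at open: 8
typed (1 target, 3 cruxes, 3 support, 1 assembly) + 1 informal support + 2 definition requests filed
after open.

DEFINITION REQUESTS. Filed right after open (ledger workitem add --kind definition …, --for the
informal RSS item): (D1) `InfiniteHardSphereFlow` — Alexander's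
a.s.-defined infinite-volume hard-sphere dynamics on locally finite marked configurations of ℝ³×ℝ³
(Alexander1975; reuse
Literature.Analysis.FunctionSpaces.PointConfig), topic Literature/MathematicalPhysics/KineticTheory;
(D2) `riemannLocalGibbsLaw` — the
infinite-volume (grand-canonical, DLR) hard-sphere local Gibbs point process with half-space-wise
constant activity / drift / temperature,
same topic. Both are also the definitions wanted by GibbsErgodicity (stmt-AtomisticToContinuum-0779,
seven refuter/grounder notes). No cite
facts requested: the PDE input is filed as crux 3, not imported as a hypothesis.

Novelty: Searches (2026-08-15): card + refuter audit searches inherited (crossref: Rost 1981 hit; Chen–Frid 3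
hits; blast/cold-gas 4 hits; FKV,
Feireisl–Kreml, Chen–Chen; Doyon–Spohn); this session: `lit frontier AtomisticToContinuum --since
2021` (30 rows: Bose gas, DHM Boltzmann,
heat equation from deterministic dynamics arXiv:2310.13338 — nothing on Riemann data for particle
systems); `lit search --source crossref
"uniqueness rarefaction waves multidimensional compressible Euler general equation of state"` (8:
FeireislKreml2015 doi:10.1142/s0219891615500149,
Lai 2021, …); `… "stability rarefaction wave full Euler relative energy Navier–Stokes–Fourier
vanishing dissipation general pressure law"` (8:
Feireisl 2016 doi:10.4310/cms.2016.v14.n6.a4, FeireislNeves2025 doi:10.1016/j.jfa.2025.110840,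
Li–Luo 2022, Li–Chen–Chen 2023 planar
rarefaction stability for 3-D full NS); `… "hard sphere fluid Riemann problem molecular dynamics
shock tube rarefaction Euler comparison"`
(8: Toro/GRP textbook chapters only); `… "Rost non-equilibrium behaviour many particle process"`
(Rost1981 doi:10.1007/bf00536194);
`lit read arXiv:1412.1903 pp. 1–6` (FKV Thm 2.1, class (2.1)–(2.8)); `lit galaxy search --star all`
×3 ("Riemann problem hard sphere
molecular dynamics rarefaction", "molecular dynamics of the Riemann problem", "shock tube molecular
dynamics"): 0 rows (galaxy substring
index saturated/empty this hour, logged); openalex/s2 rate-limited (429), zbmath/arxiv 0.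
Nearest prior art found: Rost1981  [refs: 10.1142/s0219891615500149, 10.4310/cms.2016.v14.n6.a4, 10.1016/j.jfa.2025.110840, 10.1007/bf00536194, 2310.13338, 1412.1903, doi:10.1142/s0219891615500149, doi:10.4310/cms.2016.v14.n6.a4, doi:10.1016/j.jfa.2025.110840, doi:10.1007/bf00536194, FeireislKreml2015, FeireislNeves2025, Rost1981, ChenFrid2000, FeireislKremlVasseur2015, DoyonSpohn2017, ChakrabortiEtAl2021]

Barriers (technique_class: scaling-covariance self-similar-relaxation relative-energy): - technique_class: scaling-covariance self-similar-relaxation relative-energy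
- Literature.Barriers.AtomisticToContinuum.WildSolutionsBarrier: evaded by the datum, not assumed
away — its kernel needs a SHOCK in the Riemann pattern (colliding streams; Markfelder Table 8.1),
while pull-apart data are rarefaction-only, the pattern listed under evasions_known (ii); the
colliding wall that periodicity forces at x₁ = ±1/2 is kept outside the causal slab |x₁| < 1/8, t <
t₁, and crux 3 is stated on a domain of dependence, never globally on 𝕋³.
- Literature.Barriers.AtomisticToContinuum.ShockFormationBarrier: not met — no classical solution is
continued past a gradient catastrophe; the target is Lipschitz for t > 0 by construction and t₁ is
below the shock time of anything inside the slab.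
- Literature.Barriers.AtomisticToContinuum.NoBVEstimatesMultiDBarrier: not met — no BV or
L¹-stability of competitors is used; uniqueness is by relative energy against one Lipschitz
self-similar target (FKV), which needs only L^∞ bounds.
- Literature.Barriers.AtomisticToContinuum.NonAttractiveSystemsBarrier: not met — no coupling /
order preservation; Rost1981 enters only as the prototype of the N ↔ t trade, not through
attractiveness.
- Literature.Barriers.AtomisticToContinuum.BoltzmannHypothesisBarrier: it does not evade it; the bet
is that the closure crux (FanLocalEquilibrium) is provable FIRST in this arena — one relaxing orbit,
exact equilibrium far field, expanding flow, isentropic Lipschitz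

Novelty grade: new-combination — ROUTE-REVIEW (refuter, 2026-08-15) — route CLOSED(retired) by operator 13:45:56Z (D-0027 §2.1 not-a-thesis: assembly concludes WallFanLimit, a declared companion target, not HydrodynamicLimit) during this review. Substantive findings for any reuse of the items: (1) WallFanLimit 6881 elaborates (W3.l (refuter refuter-rreview-route-AtomisticToContinu-680f7413-0, 2026-08-15T13:57:32Z; prior: doi:10.1007/bf00536194, doi:10.1090/s0002-9947-00-02660-x, arXiv:1412.1903, doi:10.1088/1742-5468/aa7abf)

History (route lifecycle, newest last):
- 2026-08-15T13:45:56Z · CLOSED retired — not-a-thesis: assembly does not conclude the sub-problem Statement (operator:999:1257524)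

sub-problem: HydrodynamicLimit · status: closed(retired) · opened planner-plancard-AtomisticToContinuum-Hydrody-87cda18c-0 2026-08-15T11:54:37Z · rev 0 · ledger route-AtomisticToContinuum-RiemannSelfSimilar
GENERATED by the gate from the ledger (D-0016/17). Provers cite these decls: `theorem foo : Summit.AtomisticToContinuum.HydrodynamicLimit.Theses.RiemannSelfSimilar.<Decl> := …` in Summits/AtomisticToContinuum/HydrodynamicLimit/Theorems/<Name>.lean.
-/

namespace Summit.AtomisticToContinuum.HydrodynamicLimit.Theses.RiemannSelfSimilar

open scoped BigOperators Topology Manifold Classical MeasureTheory ProbabilityTheory Matrix InnerProductSpace ComplexConjugate ContinuousMap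
open Filter Set Function TopologicalSpace MeasureTheory

attribute [summit_statement] _root_.HydrodynamicLimit

/-- item stmt-AtomisticToContinuum-6881 · target · rank 0 · closed · moot by None · by planner
why it might fail: False if the domain-wall gas relaxes onto a non-Euler self-similar profile (1-D hard rods do exactly that: DoyonSpohn2017) or keeps an anisotropic-pressure plateau inside the fan; vacuity risk if the t = 0 LLN hypothesis fails (support WallDataLLN).
sources: Spohn1991, OllaVaradhanYau1993, FeireislKremlVasseur2015 = arXiv:1412.1903 = doi:10.1137/140999827, Rost1981 = doi:10.1007/bf00536194, DoyonSpohn2017 = doi:10.1088/1742-5468/aa7abf, ChakrabortiEtAl2021 = doi:10.1103/physrevlett.126.244503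
[target] X as in § Thesis: for every θ̄ > 0 there is a₀ > 0, for every 0 < a < a₀ there is σ₀ > 0,
for every 0 < σ < σ₀ there are a continuous self-similar pull-apart fan (R, U, Θ) of the hard-sphere
Euler system with reduced diameter σ (bounded, ρ, θ ≥ m > 0, far field (1, ±a, θ̄), the three
self-similar balance laws in D′(ℝ)) and t₁ > 0 such that for every family of hard-sphere flows, if
the local Gibbs laws of the domain-wall datum (activity 1, velocity a·sgn(x₁)e₁, temperature θ̄)
satisfy the LLN at t = 0, then for every t ∈ (0, t₁) and every continuous χ vanishing on {|x₁| ≥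
1/8} the empirical density, momentum and energy fields at time t converge in probability to ∫χ
R(x₁/t), ∫χ R U(x₁/t) e₁, ∫χ E_W(x₁/t) (x₁ = the coordinate in [−1/2, 1/2); e₁ and x₁ are bound by
defining hypotheses at the head of the term). -/
@[route_item "route-AtomisticToContinuum-RiemannSelfSimilar"]
def WallFanLimit : Prop :=
  ∀ x1 : Literature.MathematicalPhysics.KineticTheory.T3 → ℝ, (∀ x, x1 x = ((AddCircle.equivIco (1:ℝ) (-(1/2:ℝ))) (x 0) : ℝ)) → ∀ e : Literature.MathematicalPhysics.KineticTheory.V3, e = EuclideanSpace.single 0 1 → ∀ θb : ℝ, 0 < θb → ∃ a₀ : ℝ, 0 < a₀ ∧ ∀ a : ℝ, 0 < a → a < a₀ → ∃ σ₀ : ℝ, 0 < σ₀ ∧ ∀ σ : ℝ, 0 < σ → σ < σ₀ → ∃ R U Θ : ℝ → ℝ, (Continuous R ∧ Continuous U ∧ Continuous Θ ∧ (∃ m M : ℝ, 0 < m ∧ ∀ ζ, m ≤ R ζ ∧ R ζ ≤ M ∧ m ≤ Θ ζ ∧ Θ ζ ≤ M ∧ |U ζ| ≤ M) ∧ (∃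 L : ℝ, ∀ ζ, L ≤ |ζ| → R ζ = 1 ∧ Θ ζ = θb ∧ U ζ = a * Real.sign ζ) ∧ ∀ φ : ℝ → ℝ, ContDiff ℝ (⊤ : ℕ∞) φ → HasCompactSupport φ → (∫ ζ, (R ζ * U ζ - ζ * R ζ) * deriv φ ζ = ∫ ζ, R ζ * φ ζ) ∧ (∫ ζ, (R ζ * U ζ ^ 2 + Literature.MathematicalPhysics.KineticTheory.hsPressure σ (R ζ) (Θ ζ) - ζ * (R ζ * U ζ)) * deriv φ ζ = ∫ ζ, R ζ * U ζ * φ ζ) ∧ (∫ ζ, ((Literature.MathematicalPhysics.KineticTheory.totalEnergyDensity (R ζ) (U ζ • e) (Θ ζ) + Literature.MathematicalPhysics.KineticTheory.hsPressure σ (R ζ) (Θ ζ)) * U ζ - ζ * Literature.MathematicalPhysics.KineticTheory.totalEnergyDensity (R ζ) (U ζ • e) (Θ ζ)) * deriv φ ζ = ∫ ζ, Literature.MathematicalPhysics.KineticTheory.totalEnergyDensity (R ζ) (U ζ • e) (Θ ζ) * φ ζ)) ∧ ∃ t₁ : ℝ, 0 < t₁ ∧ ∀ Φ : ((N : ℕ)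 → Literature.Analysis.FluidPDE.HardSphereFlow (Literature.Analysis.FluidPDE.Torus.geometry (Fin 3)) (Literature.MathematicalPhysics.KineticTheory.hsDiameter σ N) (N + 1)), Literature.MathematicalPhysics.KineticTheory.TendstoHydroFieldsAt (fun N => Literature.MathematicalPhysics.KineticTheory.localGibbsLaw σ (fun _ => 1) (fun x => (a * Real.sign (x1 x)) • e) (fun _ => θb) N (Φ N)) Φ (fun _ _ => (1:ℝ)) (fun _ x => (a * Real.sign (x1 x)) • e) (fun _ _ => θb) 0 → ∀ t ∈ Set.Ioo 0 t₁, ∀ χ : Literature.MathematicalPhysics.KineticTheory.T3 → ℝ, Continuous χ → (∀ x, 1/8 ≤ |x1 x| → χ x = 0) → ∀ δ : ℝ, 0 < δ → Filter.Tendsto (fun N => Literature.MathematicalPhysics.KineticTheory.localGibbsLaw σ (fun _ => 1) (fun x => (a * Real.sign (x1 x)) • e) (fun _ => θb) N (Φ N) {z | δ < |Literature.MathematicalPhysics.KineticTheory.empiricalDensityField ((Φ N).flow t z) χ - ∫ x, χ x * R (x1 x / t)|}) Filter.atTop (nhds 0) ∧ Filter.Tendsto (fun N => Literature.MathematicalPhysics.KineticTheory.localGibbsLaw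 σ (fun _ => 1) (fun x => (a * Real.sign (x1 x)) • e) (fun _ => θb) N (Φ N) {z | δ < ‖Literature.MathematicalPhysics.KineticTheory.empiricalMomentumField ((Φ N).flow t z) χ - ∫ x, (χ x * (R (x1 x / t) * U (x1 x / t))) • e‖}) Filter.atTop (nhds 0) ∧ Filter.Tendsto (fun N => Literature.MathematicalPhysics.KineticTheory.localGibbsLaw σ (fun _ => 1) (fun x => (a * Real.sign (x1 x)) • e) (fun _ => θb) N (Φ N) {z | δ < |Literature.MathematicalPhysics.KineticTheory.empiricalEnergyField ((Φ N).flow t z) χ - ∫ x, χ x * Literature.MathematicalPhysics.KineticTheory.totalEnergyDensity (R (x1 x / t)) (U (x1 x / t) • e) (Θ (x1 x / t))|}) Filter.atTop (nhds 0)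

/-- item stmt-AtomisticToContinuum-6882 · crux · rank 2 · closed · moot by None · by planner
why it might fail: Closure for deterministic hard spheres is open even here: expansion along e₁ cools v₁ first; if collisions in the fan (rate ∝ σ²N^(1/3) per unit time) leave an O(1) velocity anisotropy, or fast particles from the colliding wall pollute the slab, the one-particle law is not the fan's Maxwellian.
sources: Spohn1991, OllaVaradhanYau1993, Rost1981 = doi:10.1007/bf00536194, DoyonSpohn2017 = doi:10.1088/1742-5468/aa7abf, BoldrighiniDobrushinSukhov1983
[crux] (card R1, the closure crux in its strong one-particle form) same quantifier prefix as the
target; conclusion: for t ∈ (0, t₁) and every continuous g(x, v) with |g| ≤ C(1 + |v|²) vanishing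
for |x₁| ≥ 1/8, ∫ g d(empirical measure at time t) → ∫∫ g(x, v) R(x₁/t) M_{U(x₁/t)e₁, Θ(x₁/t)}(v) dv
dx in probability — the one-particle law inside the causal slab is the local Maxwellian of the fan,
with energy moments (uniform integrability of |v|² is part of the claim). Natural proof currency
(card point 2): Cesàro averages in log-time τ = log s of the self-similarly rescaled state, for
which limit points are automatically self-similar; identification by LocalRarefactionUniquenessHs.
[deps: LocalRarefactionUniquenessHs, KineticFluxClosure] [difficulty: open-problem] -/
@[route_item "route-AtomisticToContinuum-RiemannSelfSimilar"]
def FanLocalEquilibrium : Prop :=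
  ∀ x1 : Literature.MathematicalPhysics.KineticTheory.T3 → ℝ, (∀ x, x1 x = ((AddCircle.equivIco (1:ℝ) (-(1/2:ℝ))) (x 0) : ℝ)) → ∀ e : Literature.MathematicalPhysics.KineticTheory.V3, e = EuclideanSpace.single 0 1 → ∀ θb : ℝ, 0 < θb → ∃ a₀ : ℝ, 0 < a₀ ∧ ∀ a : ℝ, 0 < a → a < a₀ → ∃ σ₀ : ℝ, 0 < σ₀ ∧ ∀ σ : ℝ, 0 < σ → σ < σ₀ → ∃ R U Θ : ℝ → ℝ, (Continuous R ∧ Continuous U ∧ Continuous Θ ∧ (∃ m M : ℝ, 0 < m ∧ ∀ ζ, m ≤ R ζ ∧ R ζ ≤ M ∧ m ≤ Θ ζ ∧ Θ ζ ≤ M ∧ |U ζ| ≤ M) ∧ (∃ L : ℝ, ∀ ζ, L ≤ |ζ| → R ζ = 1 ∧ Θ ζ = θb ∧ U ζ = a * Real.sign ζ) ∧ ∀ φ : ℝ → ℝ, ContDiff ℝ (⊤ : ℕ∞) φ → HasCompactSupport φ → (∫ ζ, (R ζ * U ζ - ζ * R ζ) * deriv φ ζ = ∫ ζ, R ζ *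 φ ζ) ∧ (∫ ζ, (R ζ * U ζ ^ 2 + Literature.MathematicalPhysics.KineticTheory.hsPressure σ (R ζ) (Θ ζ) - ζ * (R ζ * U ζ)) * deriv φ ζ = ∫ ζ, R ζ * U ζ * φ ζ) ∧ (∫ ζ, ((Literature.MathematicalPhysics.KineticTheory.totalEnergyDensity (R ζ) (U ζ • e) (Θ ζ) + Literature.MathematicalPhysics.KineticTheory.hsPressure σ (R ζ) (Θ ζ)) * U ζ - ζ * Literature.MathematicalPhysics.KineticTheory.totalEnergyDensity (R ζ) (U ζ • e) (Θ ζ)) * deriv φ ζ = ∫ ζ, Literature.MathematicalPhysics.KineticTheory.totalEnergyDensity (R ζ) (U ζ • e) (Θ ζ) * φ ζ)) ∧ ∃ t₁ : ℝ, 0 < t₁ ∧ ∀ Φ : ((N : ℕ) → Literature.Analysis.FluidPDE.HardSphereFlow (Literature.Analysis.FluidPDE.Torus.geometry (Fin 3)) (Literature.MathematicalPhysics.KineticTheory.hsDiameter σ N) (N + 1)), Literature.MathematicalPhysics.KineticTheory.TendstoHydroFieldsAt (fun N => Literature.MathematicalPhysics.KineticTheory.localGibbsLaw σ (fun _ =>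 1) (fun x => (a * Real.sign (x1 x)) • e) (fun _ => θb) N (Φ N)) Φ (fun _ _ => (1:ℝ)) (fun _ x => (a * Real.sign (x1 x)) • e) (fun _ _ => θb) 0 → ∀ t ∈ Set.Ioo 0 t₁, ∀ g : Literature.MathematicalPhysics.KineticTheory.T3 × Literature.MathematicalPhysics.KineticTheory.V3 → ℝ, Continuous g → (∃ C : ℝ, ∀ p, |g p| ≤ C * (1 + ‖p.2‖ ^ 2)) → (∀ p, 1/8 ≤ |x1 p.1| → g p = 0) → ∀ δ : ℝ, 0 < δ → Filter.Tendsto (fun N => Literature.MathematicalPhysics.KineticTheory.localGibbsLaw σ (fun _ => 1) (fun x => (a * Real.sign (x1 x)) • e) (fun _ => θb) N (Φ N) {z | δ < |(∫ p, g p ∂(Literature.Analysis.FluidPDE.empiricalMeasure ((Φ N).flow t z))) - ∫ x, ∫ v, g (x, v) * Literature.Analysis.FluidPDE.localMaxwellian (R (x1 x / t)) (Θ (x1 x / t)) (U (x1 x / t) • e) v|}) Filter.atTop (nhds 0)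

/-- item stmt-AtomisticToContinuum-6883 · crux · rank 3 · closed · moot by None · by planner
why it might fail: FKV §4 uses ideal-gas identities (Θ = R^(1/c_v)e^(S/c_v), |∂Θ/∂U|² = Θ/(c_v(c_v+1))) to sign the singular cross terms; for p = ρθZ(ρσ³) they must be redone, and the cone-localised relative energy with a comparator singular at t = 0 (boundary flux sign) is not in print.
sources: FeireislKremlVasseur2015 = arXiv:1412.1903 = doi:10.1137/140999827, FeireislKreml2015 = doi:10.1142/s0219891615500149, FeireislNeves2025 = doi:10.1016/j.jfa.2025.110840, ChenFrid2000 = doi:10.1090/s0002-9947-00-02660-x, Dafermos2005, FeireislNovotny2012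
[crux] (card R3a; PDE) FKV for the hard-sphere equation of state, localised to a domain of
dependence: ∃ η₀ > 0 such that for every σ > 0, θ̄ > 0, a > 0 and every continuous self-similar
pull-apart fan (R, U, Θ) with packing Rσ³ < η₀ there is a signal speed c > 0 such that for every t₁
> 0, every bounded admissible weak solution (ρ, u, θ) of the hs-Euler system in the cone {0 < t <
t₁, |x₁| < 1/4 − ct} over the wall datum — measurable, m ≤ ρ, θ ≤ M, |u| ≤ M, packing < η₀, weak
mass/momentum/energy identities and the entropy inequalities ∂ₜ(ρb(s)) + div(ρb(s)u) ≥ 0 for all b ∈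
C¹ with b′ ≥ 0 (s = 3/2 log θ − log ρ − f_ex(ρσ³)), all against smooth test functions supported
inside the cone — coincides a.e. in the cone with (R, U e₁, Θ)(x₁/t). FeireislKremlVasseur2015 Thm
2.1 is the ideal-gas, ℝ×𝕋¹, global version. (In the Lean term the abbreviations x1 = coordinate in
[−1/2,1/2), e = e₁, En = totalEnergyDensity, Dt/Dx = torus time/partial derivatives, pr = hsPressure
σ, s = hs specific entropy, C = smooth test functions supported inside the cone are bound by
defining hypotheses at the head, to stay under the gate's 4000-character cap; vector test functions
enter componentwise.) [deps: -/
@[route_item "route-AtomisticToContinuum-RiemannSelfSimilar"]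
def LocalRarefactionUniquenessHs : Prop :=
  ∀ x1 : Literature.MathematicalPhysics.KineticTheory.T3 → ℝ, (∀ x, x1 x = ((AddCircle.equivIco (1:ℝ) (-(1/2:ℝ))) (x 0) : ℝ)) → ∀ e : Literature.MathematicalPhysics.KineticTheory.V3, e = EuclideanSpace.single 0 1 → ∀ En : ℝ → Literature.MathematicalPhysics.KineticTheory.V3 → ℝ → ℝ, En = Literature.MathematicalPhysics.KineticTheory.totalEnergyDensity → ∀ Dt : (ℝ → Literature.MathematicalPhysics.KineticTheory.T3 → ℝ) → ℝ → Literature.MathematicalPhysics.KineticTheory.T3 → ℝ, Dt = Literature.Analysis.FunctionSpaces.Torus.timeDeriv → ∀ Dx : Fin 3 → (Literature.MathematicalPhysics.KineticTheory.T3 → ℝ) → Literature.MathematicalPhysics.KineticTheory.T3 → ℝ, Dx = Literature.Analysis.FunctionSpaces.Torus.partialDeriv → ∃ η₀ : ℝ, 0 < η₀ ∧ ∀ σ : ℝ, 0 < σ → ∀ pr : ℝ → ℝ → ℝ, pr = Literature.MathematicalPhysics.KineticTheory.hsPressure σ → ∀ s : ℝ → ℝ → ℝ, (∀ r q, s r q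 = 3 / 2 * Real.log q - Real.log r - Literature.MathematicalPhysics.KineticTheory.hsExcessFreeEnergy (r * σ ^ 3)) → ∀ θb : ℝ, 0 < θb → ∀ a : ℝ, 0 < a → ∀ R U Θ : ℝ → ℝ, (Continuous R ∧ Continuous U ∧ Continuous Θ ∧ (∃ m M : ℝ, 0 < m ∧ ∀ ζ, m ≤ R ζ ∧ R ζ ≤ M ∧ m ≤ Θ ζ ∧ Θ ζ ≤ M ∧ |U ζ| ≤ M) ∧ (∃ L : ℝ, ∀ ζ, L ≤ |ζ| → R ζ = 1 ∧ Θ ζ = θb ∧ U ζ = a * Real.sign ζ) ∧ ∀ φ : ℝ → ℝ, ContDiff ℝ (⊤ : ℕ∞) φ → HasCompactSupport φ → (∫ ζ, (R ζ * U ζ - ζ * R ζ) * deriv φ ζ = ∫ ζ, R ζ * φ ζ) ∧ (∫ ζ, (R ζ * U ζ ^ 2 + pr (R ζ) (Θ ζ) - ζ * (R ζ * U ζ)) * deriv φ ζ = ∫ ζ, R ζ * U ζ * φ ζ) ∧ (∫ ζ, ((En (R ζ) (U ζ • e) (Θ ζ) + pr (R ζ) (Θ ζ)) * U ζ - ζ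 * En (R ζ) (U ζ • e) (Θ ζ)) * deriv φ ζ = ∫ ζ, En (R ζ) (U ζ • e) (Θ ζ) * φ ζ)) → (∀ ζ, R ζ * σ ^ 3 < η₀) → ∃ c : ℝ, 0 < c ∧ ∀ t₁ : ℝ, 0 < t₁ → ∀ C : (ℝ → Literature.MathematicalPhysics.KineticTheory.T3 → ℝ) → Prop, (∀ φ, C φ ↔ (Literature.Analysis.FunctionSpaces.Torus.IsSmoothSpaceTimeOn Set.univ φ ∧ ∃ ε : ℝ, 0 < ε ∧ (∀ t x, 1/4 - c * t - ε ≤ |x1 x| → φ t x = 0) ∧ (∀ t, t₁ - ε ≤ t → ∀ x, φ t x = 0))) → ∀ (ρ θ : ℝ → Literature.MathematicalPhysics.KineticTheory.T3 → ℝ) (u : ℝ → Literature.MathematicalPhysics.KineticTheory.T3 → Literature.MathematicalPhysics.KineticTheory.V3), (Measurable (Function.uncurry ρ) ∧ Measurable (Function.uncurry u) ∧ Measurable (Function.uncurry θ) ∧ (∃ m M : ℝ, 0 < m ∧ ∀ t x, m ≤ ρ t x ∧ ρ t x ≤ M ∧ m ≤ θ t x ∧ θ t x ≤ M ∧ ‖u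 t x‖ ≤ M) ∧ (∀ φ, C φ → (∫ t in Set.Ioo 0 t₁, ∫ x, (ρ t x * Dt φ t x + ρ t x * ∑ j, u t x j * Dx j (φ t) x)) + ∫ x, φ 0 x = 0) ∧ (∀ w : Fin 3 → ℝ → Literature.MathematicalPhysics.KineticTheory.T3 → ℝ, (∀ i, C (w i)) → (∫ t in Set.Ioo 0 t₁, ∫ x, (ρ t x * ∑ i, u t x i * Dt (w i) t x + ρ t x * ∑ i, ∑ j, u t x i * u t x j * Dx j (w i t) x + pr (ρ t x) (θ t x) * ∑ i, Dx i (w i t) x)) + ∫ x, ∑ i, ((a * Real.sign (x1 x)) • e) i * w i 0 x = 0) ∧ (∀ ψ, C ψ → (∫ t in Set.Ioo 0 t₁, ∫ x, (En (ρ t x) (u t x) (θ t x) * Dt ψ t x + (En (ρ t x) (u t x) (θ t x) + pr (ρ t x) (θ t x)) * ∑ j, u t x j * Dx j (ψ t) x)) + ∫ x, En 1 ((a * Real.sign (x1 x)) • e) θb * ψ 0 x = 0) ∧ (∀ b : ℝ → ℝ, ContDiff ℝ 1 b → (∀ r, 0 ≤ deriv b r) → ∀ φ, C φ → (∀ t x,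 0 ≤ φ t x) → (∫ t in Set.Ioo 0 t₁, ∫ x, (ρ t x * b (s (ρ t x) (θ t x)) * Dt φ t x + ρ t x * b (s (ρ t x) (θ t x)) * ∑ j, u t x j * Dx j (φ t) x)) + ∫ x, b (s 1 θb) * φ 0 x ≤ 0)) → (∀ t x, ρ t x * σ ^ 3 < η₀) → ∀ᵐ p ∂(MeasureTheory.volume.restrict {p : ℝ × Literature.MathematicalPhysics.KineticTheory.T3 | 0 < p.1 ∧ p.1 < t₁ ∧ |x1 p.2| < 1/4 - c * p.1}), ρ p.1 p.2 = R (x1 p.2 / p.1) ∧ u p.1 p.2 = U (x1 p.2 / p.1) • e ∧ θ p.1 p.2 = Θ (x1 p.2 / p.1)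

/-- item stmt-AtomisticToContinuum-6884 · crux · rank 4 · closed · moot by None · by planner
why it might fail: Third velocity moments need uniform integrability of |v|³ at time t, which no conservation law supplies (OVY exclude |p|²/2 for this reason: HighMomentumCutoffBarrier); a vanishing fraction of fast particles made by collision cascades in the fan could carry O(1) energy flux.
sources: Spohn1991, OllaVaradhanYau1993, EyinkLebowitzSpohn1991
[crux] (kinetic half of flux closure; the collisional half — contact correlations giving ρθ(Z − 1) —
stays inside crux 2's layer-2 split) same prefix as the target; conclusion: for t ∈ (0, t₁),
continuous χ vanishing for |x₁| ≥ 1/8 and j, k ∈ Fin 3, the empirical kinetic stress ∫ χ(x) v_j v_k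
d(emp. measure at t) → ∫ χ (R U² e₁⊗e₁ + RΘ𝟙)_{jk}(x₁/t) dx and the empirical kinetic energy flux ∫
χ(x) v_j |v|²/2 → ∫ χ (E_W + RΘ) U (e₁)_j (x₁/t) dx in probability (Maxwellian second and third
moments of the fan). [deps: FanLocalEquilibrium] [difficulty: XL] -/
@[route_item "route-AtomisticToContinuum-RiemannSelfSimilar"]
def KineticFluxClosure : Prop :=
  ∀ x1 : Literature.MathematicalPhysics.KineticTheory.T3 → ℝ, (∀ x, x1 x = ((AddCircle.equivIco (1:ℝ) (-(1/2:ℝ))) (x 0) : ℝ)) → ∀ e : Literature.MathematicalPhysics.KineticTheory.V3, e = EuclideanSpace.single 0 1 → ∀ θb : ℝ, 0 < θb → ∃ a₀ : ℝ, 0 < a₀ ∧ ∀ a : ℝ, 0 < a → a < a₀ → ∃ σ₀ : ℝ, 0 < σ₀ ∧ ∀ σ : ℝ, 0 < σ → σ < σ₀ → ∃ R U Θ : ℝ → ℝ, (Continuous R ∧ Continuous U ∧ Continuous Θ ∧ (∃ m M : ℝ, 0 < m ∧ ∀ ζ, m ≤ R ζ ∧ R ζ ≤ M ∧ m ≤ Θ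 ζ ∧ Θ ζ ≤ M ∧ |U ζ| ≤ M) ∧ (∃ L : ℝ, ∀ ζ, L ≤ |ζ| → R ζ = 1 ∧ Θ ζ = θb ∧ U ζ = a * Real.sign ζ) ∧ ∀ φ : ℝ → ℝ, ContDiff ℝ (⊤ : ℕ∞) φ → HasCompactSupport φ → (∫ ζ, (R ζ * U ζ - ζ * R ζ) * deriv φ ζ = ∫ ζ, R ζ * φ ζ) ∧ (∫ ζ, (R ζ * U ζ ^ 2 + Literature.MathematicalPhysics.KineticTheory.hsPressure σ (R ζ) (Θ ζ) - ζ * (R ζ * U ζ)) * deriv φ ζ = ∫ ζ, R ζ * U ζ * φ ζ) ∧ (∫ ζ, ((Literature.MathematicalPhysics.KineticTheory.totalEnergyDensity (R ζ) (U ζ • e) (Θ ζ) + Literature.MathematicalPhysics.KineticTheory.hsPressure σ (R ζ) (Θ ζ)) * U ζ - ζ * Literature.MathematicalPhysics.KineticTheory.totalEnergyDensity (R ζ) (U ζ • e) (Θ ζ)) * deriv φ ζ = ∫ ζ, Literature.MathematicalPhysics.KineticTheory.totalEnergyDensity (R ζ) (U ζ • e) (Θ ζ) * φ ζ)) ∧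 ∃ t₁ : ℝ, 0 < t₁ ∧ ∀ Φ : ((N : ℕ) → Literature.Analysis.FluidPDE.HardSphereFlow (Literature.Analysis.FluidPDE.Torus.geometry (Fin 3)) (Literature.MathematicalPhysics.KineticTheory.hsDiameter σ N) (N + 1)), Literature.MathematicalPhysics.KineticTheory.TendstoHydroFieldsAt (fun N => Literature.MathematicalPhysics.KineticTheory.localGibbsLaw σ (fun _ => 1) (fun x => (a * Real.sign (x1 x)) • e) (fun _ => θb) N (Φ N)) Φ (fun _ _ => (1:ℝ)) (fun _ x => (a * Real.sign (x1 x)) • e) (fun _ _ => θb) 0 → ∀ t ∈ Set.Ioo 0 t₁, ∀ χ : Literature.MathematicalPhysics.KineticTheory.T3 → ℝ, Continuous χ → (∀ x, 1/8 ≤ |x1 x| → χ x = 0) → ∀ j k : Fin 3, ∀ δ : ℝ, 0 < δ → Filter.Tendsto (fun N => Literature.MathematicalPhysics.KineticTheory.localGibbsLaw σ (fun _ => 1) (fun x => (a * Real.sign (x1 x)) • e) (fun _ => θb) N (Φ N) {z | δ < |(∫ p, χ p.1 * (p.2 j * p.2 k) ∂(Literature.Analysis.FluidPDE.empiricalMeasure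 ((Φ N).flow t z))) - ∫ x, χ x * (R (x1 x / t) * (U (x1 x / t) • e) j * (U (x1 x / t) • e) k + (if j = k then R (x1 x / t) * Θ (x1 x / t) else 0))|}) Filter.atTop (nhds 0) ∧ Filter.Tendsto (fun N => Literature.MathematicalPhysics.KineticTheory.localGibbsLaw σ (fun _ => 1) (fun x => (a * Real.sign (x1 x)) • e) (fun _ => θb) N (Φ N) {z | δ < |(∫ p, χ p.1 * (p.2 j * (‖p.2‖ ^ 2 / 2)) ∂(Literature.Analysis.FluidPDE.empiricalMeasure ((Φ N).flow t z))) - ∫ x, χ x * ((Literature.MathematicalPhysics.KineticTheory.totalEnergyDensity (R (x1 x / t)) (U (x1 x / t) • e) (Θ (x1 x / t)) + R (x1 x / t) * Θ (x1 x / t)) * (U (x1 x / t) • e) j)|}) Filter.atTop (nhds 0)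

/-- item stmt-AtomisticToContinuum-6885 · support · rank 9 · closed · moot by None · by planner
sources: MenikoffPlohr1989 = doi:10.1103/RevModPhys.61.75, Dafermos2005, ChenFrid2000 = doi:10.1090/s0002-9947-00-02660-x
[support] (classical Riemann problem for the hs gas) for every θ̄ > 0 there is a₀ > 0 (below the
vacuum threshold) such that for 0 < a < a₀ there is σ₀ > 0 with: for every 0 ≤ σ < σ₀ a continuous
self-similar pull-apart fan (R, U, Θ) exists (two centred rarefaction waves and a constant middle
state on one isentrope; σ = 0 is the explicit γ = 5/3 ideal-gas fan, small σ > 0 needs Z smooth near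
0, cf. HsEosLowDensity stmt-AtomisticToContinuum-0768). [difficulty: M] -/
@[route_item "route-AtomisticToContinuum-RiemannSelfSimilar"]
def PullApartFanExists : Prop :=
  ∀ e : Literature.MathematicalPhysics.KineticTheory.V3, e = EuclideanSpace.single 0 1 → ∀ θb : ℝ, 0 < θb → ∃ a₀ : ℝ, 0 < a₀ ∧ ∀ a : ℝ, 0 < a → a < a₀ → ∃ σ₀ : ℝ, 0 < σ₀ ∧ ∀ σ : ℝ, 0 ≤ σ → σ < σ₀ → ∃ R U Θ : ℝ → ℝ, (Continuous R ∧ Continuous U ∧ Continuous Θ ∧ (∃ m M : ℝ, 0 < m ∧ ∀ ζ, m ≤ R ζ ∧ R ζ ≤ M ∧ m ≤ Θ ζ ∧ Θ ζ ≤ M ∧ |U ζ| ≤ M) ∧ (∃ L : ℝ, ∀ ζ, L ≤ |ζ| → R ζ = 1 ∧ Θ ζ = θb ∧ U ζ = a * Real.sign ζ) ∧ ∀ φ : ℝ → ℝ, ContDiff ℝ (⊤ : ℕ∞) φ → HasCompactSupport φ → (∫ ζ, (R ζ * U ζ - ζ * R ζ) * deriv φ ζ = ∫ ζ, R ζ *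 φ ζ) ∧ (∫ ζ, (R ζ * U ζ ^ 2 + Literature.MathematicalPhysics.KineticTheory.hsPressure σ (R ζ) (Θ ζ) - ζ * (R ζ * U ζ)) * deriv φ ζ = ∫ ζ, R ζ * U ζ * φ ζ) ∧ (∫ ζ, ((Literature.MathematicalPhysics.KineticTheory.totalEnergyDensity (R ζ) (U ζ • e) (Θ ζ) + Literature.MathematicalPhysics.KineticTheory.hsPressure σ (R ζ) (Θ ζ)) * U ζ - ζ * Literature.MathematicalPhysics.KineticTheory.totalEnergyDensity (R ζ) (U ζ • e) (Θ ζ)) * deriv φ ζ = ∫ ζ, Literature.MathematicalPhysics.KineticTheory.totalEnergyDensity (R ζ) (U ζ • e) (Θ ζ) * φ ζ))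

/-- item stmt-AtomisticToContinuum-6886 · support · rank 9 · closed · moot by None · by planner
sources: Dafermos2005, ChenFrid2000 = doi:10.1090/s0002-9947-00-02660-x, MenikoffPlohr1989 = doi:10.1103/RevModPhys.61.75
[support] uniqueness of the continuous self-similar pull-apart fan among continuous self-similar
weak solutions with the same far field (structure of continuous self-similar solutions of strictly
hyperbolic genuinely nonlinear systems: constant states and centred rarefactions); pins the
∃-quantified fan of the target. [difficulty: M] -/
@[route_item "route-AtomisticToContinuum-RiemannSelfSimilar"]
def PullApartFanUnique : Prop :=
  ∀ e : Literature.MathematicalPhysics.KineticTheory.V3, e = EuclideanSpace.single 0 1 → ∃ η₀ : ℝ, 0 < η₀ ∧ ∀ σ : ℝ, 0 ≤ σ → ∀ θb : ℝ, 0 < θb → ∀ a : ℝ, 0 < a → ∀ R U Θ R' U' Θ' : ℝ → ℝ, (Continuous R ∧ Continuous U ∧ Continuous Θ ∧ (∃ m M : ℝ, 0 < m ∧ ∀ ζ, m ≤ R ζ ∧ R ζ ≤ M ∧ m ≤ Θ ζ ∧ Θ ζ ≤ M ∧ |U ζ| ≤ M) ∧ (∃ L : ℝ, ∀ ζ, L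 ≤ |ζ| → R ζ = 1 ∧ Θ ζ = θb ∧ U ζ = a * Real.sign ζ) ∧ ∀ φ : ℝ → ℝ, ContDiff ℝ (⊤ : ℕ∞) φ → HasCompactSupport φ → (∫ ζ, (R ζ * U ζ - ζ * R ζ) * deriv φ ζ = ∫ ζ, R ζ * φ ζ) ∧ (∫ ζ, (R ζ * U ζ ^ 2 + Literature.MathematicalPhysics.KineticTheory.hsPressure σ (R ζ) (Θ ζ) - ζ * (R ζ * U ζ)) * deriv φ ζ = ∫ ζ, R ζ * U ζ * φ ζ) ∧ (∫ ζ, ((Literature.MathematicalPhysics.KineticTheory.totalEnergyDensity (R ζ) (U ζ • e) (Θ ζ) + Literature.MathematicalPhysics.KineticTheory.hsPressure σ (R ζ) (Θ ζ)) * U ζ - ζ * Literature.MathematicalPhysics.KineticTheory.totalEnergyDensity (R ζ) (U ζ • e) (Θ ζ)) * deriv φ ζ = ∫ ζ, Literature.MathematicalPhysics.KineticTheory.totalEnergyDensity (R ζ) (U ζ • e) (Θ ζ) * φ ζ)) → (Continuous R' ∧ Continuous U' ∧ Continuous Θ' ∧ (∃ m M : ℝ, 0 < m ∧ ∀ ζ,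 m ≤ R' ζ ∧ R' ζ ≤ M ∧ m ≤ Θ' ζ ∧ Θ' ζ ≤ M ∧ |U' ζ| ≤ M) ∧ (∃ L : ℝ, ∀ ζ, L ≤ |ζ| → R' ζ = 1 ∧ Θ' ζ = θb ∧ U' ζ = a * Real.sign ζ) ∧ ∀ φ : ℝ → ℝ, ContDiff ℝ (⊤ : ℕ∞) φ → HasCompactSupport φ → (∫ ζ, (R' ζ * U' ζ - ζ * R' ζ) * deriv φ ζ = ∫ ζ, R' ζ * φ ζ) ∧ (∫ ζ, (R' ζ * U' ζ ^ 2 + Literature.MathematicalPhysics.KineticTheory.hsPressure σ (R' ζ) (Θ' ζ) - ζ * (R' ζ * U' ζ)) * deriv φ ζ = ∫ ζ, R' ζ * U' ζ * φ ζ) ∧ (∫ ζ, ((Literature.MathematicalPhysics.KineticTheory.totalEnergyDensity (R' ζ) (U' ζ • e) (Θ' ζ) + Literature.MathematicalPhysics.KineticTheory.hsPressure σ (R' ζ) (Θ' ζ)) * U' ζ - ζ * Literature.MathematicalPhysics.KineticTheory.totalEnergyDensity (R' ζ) (U' ζ • e) (Θ' ζ)) * deriv φ ζ = ∫ ζ,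 Literature.MathematicalPhysics.KineticTheory.totalEnergyDensity (R' ζ) (U' ζ • e) (Θ' ζ) * φ ζ)) → (∀ ζ, R ζ * σ ^ 3 < η₀) → (∀ ζ, R' ζ * σ ^ 3 < η₀) → R = R' ∧ U = U' ∧ Θ = Θ'

/-- item stmt-AtomisticToContinuum-6887 · support · rank 9 · closed · moot by None · by planner
sources: Spohn1991, Ruelle1969, LebowitzPenrose1964
[support] non-vacuity of the target's hypothesis: for θ̄ > 0, a > 0 and σ small, the local Gibbs
laws of the domain-wall datum are probability measures for every N and every flow family and satisfy
the LLN at t = 0 towards (1, a·sgn(x₁)e₁, 1·(a²/2 + 3θ̄/2)) (positions are the EQUILIBRIUM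
hard-sphere canonical measure at packing σ³; velocities independent local Maxwellians; low-density
decay of correlations, cf. localGibbs_lln / LocalGibbsConcentration stmt-AtomisticToContinuum-0767).
[difficulty: M] -/
@[route_item "route-AtomisticToContinuum-RiemannSelfSimilar"]
def WallDataLLN : Prop :=
  ∀ x1 : Literature.MathematicalPhysics.KineticTheory.T3 → ℝ, (∀ x, x1 x = ((AddCircle.equivIco (1:ℝ) (-(1/2:ℝ))) (x 0) : ℝ)) → ∀ e : Literature.MathematicalPhysics.KineticTheory.V3, e = EuclideanSpace.single 0 1 → ∀ θb : ℝ, 0 < θb → ∀ a : ℝ, 0 < a → ∃ σ₀ : ℝ, 0 < σ₀ ∧ ∀ σ : ℝ, 0 < σ → σ < σ₀ → ∀ Φ : ((N : ℕ) → Literature.Analysis.FluidPDE.HardSphereFlow (Literature.Analysis.FluidPDE.Torus.geometry (Fin 3)) (Literature.MathematicalPhysics.KineticTheory.hsDiameter σ N) (N + 1)), (∀ N, MeasureTheory.IsProbabilityMeasure (Literature.MathematicalPhysics.KineticTheory.localGibbsLaw σ (fun _ => 1) (fun x => (a * Real.sign (x1 x)) • e) (fun _ => θb) N (Φ N))) ∧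 Literature.MathematicalPhysics.KineticTheory.TendstoHydroFieldsAt (fun N => Literature.MathematicalPhysics.KineticTheory.localGibbsLaw σ (fun _ => 1) (fun x => (a * Real.sign (x1 x)) • e) (fun _ => θb) N (Φ N)) Φ (fun _ _ => (1:ℝ)) (fun _ x => (a * Real.sign (x1 x)) • e) (fun _ _ => θb) 0

-- item stmt-AtomisticToContinuum-7131 · support · rank 9 · closed · moot by None · by planner — informal only, no Lean statement yet:
--   [support; N-FREE FORM of the target — the card's statement RSS; informal until definitions D1
--   (InfiniteHardSphereFlow) and D2 (riemannLocalGibbsLaw) land] For the infinite-volume hard-sphere gas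
--   (reduced diameter σ, density scale 1) started from the RIEMANN LOCAL GIBBS LAW μ of the pull-apart
--   datum (density 1, temperature θ̄, drift −a·e₁ on {x₁ < 0} and +a·e₁ on {x₁ > 0}; packing σ³ < η₀, 0
--   < a < a₀(θ̄)) and evolved by Alexander's μ-a.s.-defined infinite-volume flow x_i(s), v_i(s): for
--   every ψ ∈ C_c(ℝ³) and δ > 0, μ{ |s⁻³ Σ_i ψ(x_i(s)/s)·(1, v_i(s), |v_i(s)|²/2) − ∫ ψ(y)·(R, R U e₁,
--   E_W)(y₁) d

/-- item stmt-AtomisticToContinuum-6888 · assembly · rank 1 · closed · moot by None · by planner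
sources: Spohn1991, OllaVaradhanYau1993
[assembly] FanLocalEquilibrium → WallFanLimit (choose the three test functions, Gaussian moment
identities). -/
@[route_item "route-AtomisticToContinuum-RiemannSelfSimilar"]
def Assembly : Prop :=
  FanLocalEquilibrium → WallFanLimit

end Summit.AtomisticToContinuum.HydrodynamicLimit.Theses.RiemannSelfSimilar
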